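import Summits.ResolutionOfSingularities.ResolutionOfSingularities.Theorems.WildQuotientsSummitReductionStubPairOrbitNormalFormBlowupChartsOverCentreStalkDict
import Summits.ResolutionOfSingularities.ResolutionOfSingularities.Theorems.WildQuotientsSummitReductionStubPairOrbitNormalFormBlowupChartsOverCentreTransport
import Summits.ResolutionOfSingularities.ResolutionOfSingularities.Theorems.WildQuotientsSummitReductionStubPairOrbitNormalFormBlowupChartsOverCentrePackages2
import HarnessLib

/-!
# `WildQuotients.SummitReduction` (stmt-ResolutionOfSingularities-16324), line `FramePerfect`, skeleton v11:
# stub NB2 `stub_pair_orbitNormalFormBlowup_modelChartsOverCentre` — de Jong 1996, 4.27 [C2] on the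
# coefficient-free model

Route `ResolutionOfSingularities/WildQuotients`, crux `SummitReduction`; this file PROVES the registered
stub NB2 of the line skeleton (v11), VERBATIM the hypothesis `hNB2` of
`stub_pair_orbitNormalFormBlowup_chartsOverCentre_of_model` (`…ChartsOverCentreReduction2.lean`): for a
regular local ring `A` with regular system of parameters `t : Fin m → A` (`(t) = 𝔪_A`, `dim A = m`),
`2 ≤ s ≤ r ≤ m`, `a₀ < b₀ < s`, the model `M = A⟦u, v⟧/(uv - ∏_{i<s} tᵢ)` (`DeJong1996.NodeDeformationRing`),
ANY blow-up `ρ₁ : B → Spec M` in the centre `𝔭 = (t_{a₀}, t_{b₀}) M + (u, v)` and any CLOSED point `y` of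
`B` over the closed point: the stalk ideal of the centre at `y` is `(G)` with `G` a non-zero-divisor, the
stalk ideal of the boundary `(∏_{i<r} tᵢ)` is `(G² w)` with `√((G² w) 𝒪̂_{B,y}) = (G w) 𝒪̂_{B,y}`, `(G w)`
has local strict normal crossings data if `𝒪_{B,y}` is regular, and
`(𝒪̂_{B,y}, (G w) 𝒪̂) ≅ (A'⟦u, v⟧/(uv - ∏_{i<s'} t'ᵢ), (∏_{i<r'} t'ᵢ))` for a new regular local `A'` of
dimension `m`, `2 ≤ s' ≤ r' ≤ m`, if not. This is de Jong 1996, 4.27, p. 76 ("We blow up the scheme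
`Spec k⟦u, v, t₁, …, t_{d-1}⟧/(uv - t₁ ⋯ t_s)` in the ideal `(u, v, t₁, t₂)`. We get four charts … Chart
"`u ≠ 0`" … Clearly, this is smooth and `Z` is given by `ut₁'t₂'t₃ ⋯ t_r = 0`, a normal crossings
divisor. Chart "`t₁ ≠ 0`" … `u'v' - t₂'t₃ ⋯ t_s = 0`. The divisor `Z'` is given by `t₁t₂'t₃ ⋯ t_r = 0`.
Clearly the singularities are of the type described in (ii)") made COEFFICIENT-FREE as required by
de Jong 1997, proof of Prop. 5.11 (p. 619: the same normal forms and blow-ups, the base of the node an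
arbitrary regular local ring), and at ALL closed points over the closed point (not only the rational
ones). The assembly: enumerate the branches off the centre (`modelChartsOverCentre_exists_enum`), move to
the chart through `y` and its local ring `L/(f)` with the dictionary of stalk ideals
(`modelChartsOverCentre_model_stalk`, file `…StalkDict`), take the chart package there
(`modelChartsOverCentre_package`, files `…Packages`, `…Packages2`, resting on the O3 worker's
`chartsOverCentre_chartX`, `chartsOverCentre_chartT_uu/tu/tt`, `chartsOverCentre_nodeCase`), and
transport it back to `𝒪_{B,y}` (`modelChartsOverCentre_transport`, file `…Transport`). The tree's
version over an algebraically closed field is `DeJong1996NodalBlowupFormalCharts_holds`.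

* `modelChartsOverCentre_exists_enum` — enumeration of the indices off `{a₀, b₀}` and the splitting
  `∏_{i<s} tᵢ = t_{a₀} t_{b₀} ∏_{σ k < s} t_{σ k}`;
* `modelChartsOverCentre_map_comp_centre`, `modelChartsOverCentre_map_span_singleton` — bookkeeping;
* `stub_pair_orbitNormalFormBlowup_modelChartsOverCentre` — **the stub**.

## Sources

* A. J. de Jong, *Smoothness, semi-stability and alterations*, Publ. Math. IHÉS 83 (1996), 4.27,
  pp. 75–76. [DeJong1996]
* A. J. de Jong, *Families of curves and alterations*, Ann. Inst. Fourier 47 (1997), proof of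
  Prop. 5.11, p. 619. [DeJong1997]
* The Stacks Project, Tag 0804 (charts of a blowing up). [StacksProject]
-/

set_option linter.dupNamespace false -- the tree's summit namespace repeats `ResolutionOfSingularities`

noncomputable section

open CategoryTheory CategoryTheory.Limits AlgebraicGeometry TopologicalSpace
open Literature.AlgebraicGeometry.Resolution
open Literature.AlgebraicGeometry
open IsLocalRing

namespace Summit.ResolutionOfSingularities.ResolutionOfSingularities.Theorems

/-- **Enumerating the branches off the centre**: for `a₀ ≠ b₀` in `Fin (l + 2)` there is an
enumeration `σ : Fin l → Fin (l + 2)` of the other indices, so that `(t_{a₀}, t_{b₀}, t ∘ σ)` has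
the range of `t` and, for `s` beyond `a₀, b₀`, `∏_{i<s} tᵢ = t_{a₀} t_{b₀} ∏_{σ k < s} t_{σ k}`.
[folklore] -/
theorem modelChartsOverCentre_exists_enum {M : Type} [CommMonoid M] {l : ℕ} (t : Fin (l + 2) → M)
    (a₀ b₀ : Fin (l + 2)) (hab : a₀ ≠ b₀) :
    ∃ σ : Fin l → Fin (l + 2),
      Set.range (Fin.append ![t a₀, t b₀] (fun k => t (σ k))) = Set.range t ∧
      ∀ s : ℕ, a₀.val < s → b₀.val < s →
        ∏ i ∈ Finset.univ.filter (fun i : Fin (l + 2) => i.val < s), t i =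
          t a₀ * t b₀ * ∏ k ∈ Finset.univ.filter (fun k : Fin l => (σ k).val < s), t (σ k) := by
  classical
  have hcard : ((Finset.univ.erase a₀).erase b₀).card = l := by
    rw [Finset.card_erase_of_mem (Finset.mem_erase.mpr ⟨hab.symm, Finset.mem_univ _⟩),
      Finset.card_erase_of_mem (Finset.mem_univ _), Finset.card_univ, Fintype.card_fin]
    omega
  have hσmem : ∀ k, ((Finset.univ.erase a₀).erase b₀).orderEmbOfFin hcard k ∈ (Finset.univ.erase a₀).erase b₀ :=
    fun k => Finset.orderEmbOfFin_mem _ _ k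
  have hσa : ∀ k, ((Finset.univ.erase a₀).erase b₀).orderEmbOfFin hcard k ≠ a₀ := fun k =>
    (Finset.mem_erase.mp (Finset.mem_erase.mp (hσmem k)).2).1
  have hσb : ∀ k, ((Finset.univ.erase a₀).erase b₀).orderEmbOfFin hcard k ≠ b₀ := fun k =>
    (Finset.mem_erase.mp (hσmem k)).1
  have hσinj : Function.Injective (((Finset.univ.erase a₀).erase b₀).orderEmbOfFin hcard) :=
    (((Finset.univ.erase a₀).erase b₀).orderEmbOfFin hcard).injective
  have hσsurj : ∀ i, i ≠ a₀ → i ≠ b₀ → ∃ k, ((Finset.univ.erase a₀).erase b₀).orderEmbOfFin hcard k = i := by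
    intro i hia hib
    have hi : i ∈ Set.range (((Finset.univ.erase a₀).erase b₀).orderEmbOfFin hcard) := by
      rw [Finset.range_orderEmbOfFin]
      simp [hia, hib]
    exact hi
  refine ⟨fun k => ((Finset.univ.erase a₀).erase b₀).orderEmbOfFin hcard k, ?_, fun s has hbs => ?_⟩
  · ext m
    simp only [Set.mem_range]
    constructor
    · rintro ⟨i, rfl⟩
      refine Fin.addCases (fun i => ?_) (fun k => ?_) i
      · rw [Fin.append_left]
        fin_cases i
        · exact ⟨a₀, rfl⟩
        · exact ⟨b₀, rfl⟩
      · rw [Fin.append_right]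
        exact ⟨_, rfl⟩
    · rintro ⟨i, rfl⟩
      by_cases hia : i = a₀
      · subst hia
        exact ⟨Fin.castAdd l 0, by simp⟩
      by_cases hib : i = b₀
      · subst hib
        exact ⟨Fin.castAdd l 1, by simp⟩
      obtain ⟨k, hk⟩ := hσsurj i hia hib
      exact ⟨Fin.natAdd 2 k, by simp [hk]⟩
  · have ha : a₀ ∈ Finset.univ.filter (fun i : Fin (l + 2) => i.val < s) := by simp [has]
    have hb : b₀ ∈ (Finset.univ.filter (fun i : Fin (l + 2) => i.val < s)).erase a₀ := by simp [hbs, hab.symm]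
    have hset : ((Finset.univ.filter (fun i : Fin (l + 2) => i.val < s)).erase a₀).erase b₀ =
        (Finset.univ.filter (fun k : Fin l =>
          (((Finset.univ.erase a₀).erase b₀).orderEmbOfFin hcard k).val < s)).image
          (fun k => ((Finset.univ.erase a₀).erase b₀).orderEmbOfFin hcard k) := by
      ext i
      simp only [Finset.mem_erase, Finset.mem_filter, Finset.mem_univ, true_and, Finset.mem_image]
      constructor
      · rintro ⟨hib, hia, his⟩
        obtain ⟨k, rfl⟩ := hσsurj i hia hib
        exact ⟨k, his, rfl⟩
      · rintro ⟨k, hk, rfl⟩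
        exact ⟨hσb k, hσa k, hk⟩
    rw [← Finset.mul_prod_erase _ _ ha, ← Finset.mul_prod_erase _ _ hb, hset,
      Finset.prod_image (fun k _ k' _ hkk => hσinj hkk), mul_assoc]

/-- Extension of the centre along `P → P[𝔓/g] → L → L/(f)`: `𝔓 ↦ (g)`. [folklore] -/
theorem modelChartsOverCentre_map_comp_centre {P B L O : Type} [CommRing P] [CommRing B] [CommRing L]
    [CommRing O] [Algebra P B] (𝔓 : Ideal P) (g : P)
    (h : 𝔓.map (algebraMap P B) = Ideal.span {algebraMap P B g}) (φ : B →+* L) (ψ : L →+* O) :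
    𝔓.map (ψ.comp (φ.comp (algebraMap P B))) = Ideal.span {ψ (φ (algebraMap P B g))} := by
  rw [← Ideal.map_map, ← Ideal.map_map, h, Ideal.map_span, Set.image_singleton, Ideal.map_span,
    Set.image_singleton]

/-- Extension of a principal ideal. [folklore] -/
theorem modelChartsOverCentre_map_span_singleton {P O : Type} [CommRing P] [CommRing O] (φ : P →+* O)
    (a : P) : (Ideal.span {a}).map φ = Ideal.span {φ a} := by
  rw [Ideal.map_span, Set.image_singleton]

set_option maxHeartbeats 4000000 in
/-- **Stub NB2 — de Jong 1996, 4.27 [C2] on the coefficient-free MODEL** `M = A⟦u, v⟧/(uv - t₀ ⋯ t_{s-1})`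
(`A` regular local with regular system of parameters `t`, `2 ≤ s ≤ r ≤ m = dim A`, `a₀ < b₀ < s`):
for ANY blow-up `ρ₁ : B → Spec M` in the centre `𝔭_{a₀b₀} = (t_{a₀}, t_{b₀}, u, v)` and every CLOSED
point `y` of `B` over the closed point of `Spec M`: the stalk ideal of the centre at `y` is principal
`(G)` with `G` a non-zero-divisor, the stalk ideal of the boundary `(∏_{i<r} tᵢ)` is `(G² w)`, its
completed radical is `(G w)^`, and: if `𝒪_{B,y}` is regular then `(G w)` has local strict normal
crossings data (charts "`u ≠ 0`", "`v ≠ 0`", and the regular points of the charts "`t_a ≠ 0`"), else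
`𝒪̂_{B,y} ≅ A'⟦u', v'⟧/(u'v' - ∏_{i<s'} t'ᵢ)` for a NEW regular local `A'` of dimension `m` carrying
`(G w)^` to `(∏_{i<r'} t'ᵢ)`, `2 ≤ s' ≤ r' ≤ m` (the nodes of the charts "`t_a ≠ 0`": "`u'v' - t₂'t₃ ⋯ t_s = 0`
… The divisor `Z'` is given by `t₁t₂'t₃ ⋯ t_r = 0`. Clearly the singularities are of the type described
in (ii)"). Proof: enumerate the branches off the centre (`t = (t_{a₀}, t_{b₀}, w)`), write
`uv - ∏_{i<s} tᵢ = uv - x y ∏_{k ∈ S} w_k` and the centre as `(u, v, x, y) A⟦u, v⟧` modulo the relation;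
the point `y` lies on the chart of some generator `g`, where `𝒪_{B,y} ≅ L/(f)` for the localisation
`L` of `A⟦u,v⟧[𝔓/g]` at a maximal ideal and the strict transform `f`, the stalk ideals of the centre and
of the boundary going to `(g)` and `(x y ∏_{k ∈ T} w_k)` (`modelChartsOverCentre_model_stalk`); the
chart package `modelChartsOverCentre_package` (charts `u, v`: `chartsOverCentre_chartX`; charts `x, y`:
`chartsOverCentre_chartT_uu/tu/tt` at the regular points, `chartsOverCentre_nodeCase` at the nodes) is
then transported back along `𝒪_{B,y} ≅ L/(f)` and the induced isomorphism of completions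
(`modelChartsOverCentre_transport`). The tree's version over an algebraically closed field is
`DeJong1996NodalBlowupFormalCharts_holds`.
[cite: DeJong1996, 4.27, pp. 75–76] [cite: DeJong1997, proof of Prop. 5.11, p. 619] -/
theorem stub_pair_orbitNormalFormBlowup_modelChartsOverCentre :
    ∀ (A : Type) [CommRing A] [IsRegularLocalRing A] (m : ℕ) (t : Fin m → A),
      Ideal.span (Set.range t) = IsLocalRing.maximalIdeal A → ringKrullDim A = m →
      ∀ (s r : ℕ), 2 ≤ s → s ≤ r → r ≤ m → ∀ (a₀ b₀ : Fin m), a₀ < b₀ → b₀.val < s →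
      ∀ (B : Scheme.{0}) (ρ₁ : B ⟶ Spec (.of (DeJong1996.NodeDeformationRing A
          (∏ i ∈ Finset.univ.filter (fun i : Fin m => i.val < s), t i)))),
        IsBlowup ρ₁ (Scheme.IdealSheafData.ofIdealTop
          ((((Ideal.span {t a₀, t b₀}).map (DeJong1996.NodeDeformationRing.ofBase A _) ⊔
              Ideal.span {Ideal.Quotient.mk _ (MvPowerSeries.X 0),
                Ideal.Quotient.mk _ (MvPowerSeries.X 1)})).map
            (Scheme.ΓSpecIso (.of (DeJong1996.NodeDeformationRing A
              (∏ i ∈ Finset.univ.filter (fun i : Fin m => i.val < s), t i)))).inv.hom)) →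
        ∀ y : B, IsClosed ({y} : Set B) → (∀ f, f ∈ (ρ₁.base y).asIdeal ∨ IsUnit f) →
          ∃ G w : B.presheaf.stalk y,
            stalkIdeal ((Scheme.IdealSheafData.ofIdealTop
              ((((Ideal.span {t a₀, t b₀}).map (DeJong1996.NodeDeformationRing.ofBase A _) ⊔
                Ideal.span {Ideal.Quotient.mk _ (MvPowerSeries.X 0),
                  Ideal.Quotient.mk _ (MvPowerSeries.X 1)})).map
              (Scheme.ΓSpecIso (.of (DeJong1996.NodeDeformationRing A
                (∏ i ∈ Finset.univ.filter (fun i : Fin m => i.val < s), t i)))).inv.hom)).comap ρ₁) y =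
              Ideal.span {G} ∧
            G ∈ nonZeroDivisors (B.presheaf.stalk y) ∧
            stalkIdeal ((Scheme.IdealSheafData.ofIdealTop
              ((Ideal.span {DeJong1996.NodeDeformationRing.ofBase A _
                (∏ i ∈ Finset.univ.filter (fun i : Fin m => i.val < r), t i)}).map
              (Scheme.ΓSpecIso (.of (DeJong1996.NodeDeformationRing A
                (∏ i ∈ Finset.univ.filter (fun i : Fin m => i.val < s), t i)))).inv.hom)).comap ρ₁) y =
              Ideal.span {G ^ 2 * w} ∧
            ((stalkIdeal ((Scheme.IdealSheafData.ofIdealTop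
              ((Ideal.span {DeJong1996.NodeDeformationRing.ofBase A _
                (∏ i ∈ Finset.univ.filter (fun i : Fin m => i.val < r), t i)}).map
              (Scheme.ΓSpecIso (.of (DeJong1996.NodeDeformationRing A
                (∏ i ∈ Finset.univ.filter (fun i : Fin m => i.val < s), t i)))).inv.hom)).comap ρ₁) y).map
                (algebraMap (B.presheaf.stalk y) (AdicCompletion
                  (IsLocalRing.maximalIdeal (B.presheaf.stalk y)) (B.presheaf.stalk y)))).radical =
              (Ideal.span {G * w}).map (algebraMap (B.presheaf.stalk y) (AdicCompletion
                  (IsLocalRing.maximalIdeal (B.presheaf.stalk y)) (B.presheaf.stalk y))) ∧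
            (IsRegularLocalRing (B.presheaf.stalk y) → IsSNCIdeal (Ideal.span {G * w})) ∧
            (¬ IsRegularLocalRing (B.presheaf.stalk y) →
              ∃ (A' : Type) (_ : CommRing A') (_ : IsRegularLocalRing A') (t' : Fin m → A') (s' r' : ℕ),
                Ideal.span (Set.range t') = IsLocalRing.maximalIdeal A' ∧ ringKrullDim A' = m ∧
                2 ≤ s' ∧ s' ≤ r' ∧ r' ≤ m ∧
                ∃ e : AdicCompletion (IsLocalRing.maximalIdeal (B.presheaf.stalk y))
                    (B.presheaf.stalk y) ≃+*
                    DeJong1996.NodeDeformationRing A'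
                      (∏ i ∈ Finset.univ.filter (fun i : Fin m => i.val < s'), t' i),
                  ((Ideal.span {G * w}).map (algebraMap (B.presheaf.stalk y) _)).map e.toRingHom =
                    Ideal.span {DeJong1996.NodeDeformationRing.ofBase A' _
                      (∏ i ∈ Finset.univ.filter (fun i : Fin m => i.val < r'), t' i)}) := by
  intro A _ _ m t ht hdim s r hs hsr hrm a₀ b₀ hab hb₀s B ρ₁ hB yB hyc hy
  classical
  -- `m = l + 2`
  obtain ⟨l, rfl⟩ : ∃ l, m = l + 2 := ⟨m - 2, by have := b₀.isLt; have := Fin.lt_def.mp hab; omega⟩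
  haveI := isRegularLocalRing_mvPowerSeries_of_isRegularLocalRing A 2
  -- enumerate the branches off the centre
  obtain ⟨σ, hrange, hprod⟩ := modelChartsOverCentre_exists_enum t a₀ b₀ hab.ne
  have has : a₀.val < s := lt_trans (Fin.lt_def.mp hab) hb₀s
  have hzA : Ideal.span (Set.range (Fin.append ![t a₀, t b₀] (fun k => t (σ k)))) = maximalIdeal A := by
    rw [hrange, ht]
  have hdA : (maximalIdeal A).spanFinrank = 2 + l := by
    have h1 := IsRegularLocalRing.spanFinrank_maximalIdeal (R := A)
    rw [hdim] at h1
    have h2 : (maximalIdeal A).spanFinrank = l + 2 := by exact_mod_cast h1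
    omega
  have hh : (∏ i ∈ Finset.univ.filter (fun i : Fin (l + 2) => i.val < s), t i) = t a₀ * t b₀ * ∏ k ∈ (Finset.univ.filter (fun k : Fin l =>
        (σ k).val < s)), (fun k => t (σ k)) k := hprod s has hb₀s
  have hbT : (∏ i ∈ Finset.univ.filter (fun i : Fin (l + 2) => i.val < r), t i) = t a₀ * t b₀ * ∏ k ∈ (Finset.univ.filter (fun k : Fin l =>
        (σ k).val < r)), (fun k => t (σ k)) k :=
    hprod r (lt_of_lt_of_le has hsr) (lt_of_lt_of_le hb₀s hsr)
  have hST : (Finset.univ.filter (fun k : Fin l => (σ k).val < s)) ⊆ (Finset.univ.filter (fun k : Fin l => (σ k).val < r)) := fun k hk => by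
    simp only [Finset.mem_filter, Finset.mem_univ, true_and] at hk ⊢
    exact lt_of_lt_of_le hk hsr
  -- the centre `𝔓 = (u, v, x, y)` of `P = A⟦u, v⟧` and the model relation
  obtain ⟨𝔓, h𝔓⟩ : ∃ 𝔓 : Ideal (MvPowerSeries (Fin 2) A), 𝔓 = Ideal.span (Set.range (![MvPowerSeries.X 0, MvPowerSeries.X 1, MvPowerSeries.C (t a₀)
        , MvPowerSeries.C (t b₀)] : Fin 4 → MvPowerSeries (Fin 2) A)) := ⟨_, rfl⟩
  have hc : ∀ k, (![MvPowerSeries.X 0, MvPowerSeries.X 1, MvPowerSeries.C (t a₀), MvPowerSeries.C (t b₀)] : Fin 4 → MvPowerSeries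
        (Fin 2) A) k ∈ 𝔓 := modelChartsOverCentre_mem_centre (t a₀) (t b₀) 𝔓 h𝔓
  obtain ⟨hzP, hdP⟩ := chartsOverCentre_model_rsop (t a₀) (t b₀) (fun k => t (σ k)) hzA hdA
  have hF := modelChartsOverCentre_relation_eq (t a₀) (t b₀) (fun k => t (σ k)) (Finset.univ.filter (fun k : Fin l => (σ k).val < s)) _ hh
  have hJ : 𝔓.map (Ideal.Quotient.mk (Ideal.span {DeJong1996.nodeDeformationRelation A (∏ i ∈ Finset.univ.filter (fun i : Fin (l + 2) => i.val < s)
        , t i)})) =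
      (Ideal.span {t a₀, t b₀}).map (DeJong1996.NodeDeformationRing.ofBase A _) ⊔
        Ideal.span {Ideal.Quotient.mk _ (MvPowerSeries.X 0), Ideal.Quotient.mk _ (MvPowerSeries.X 1)} := by
    rw [h𝔓, Set.range_vec4']
    exact map_mk_span_model_eq t _ a₀ b₀
  have hbd : Ideal.span {DeJong1996.NodeDeformationRing.ofBase A (∏ i ∈ Finset.univ.filter (fun i : Fin (l + 2) => i.val < s), t i)
        (∏ i ∈ Finset.univ.filter (fun i : Fin (l + 2) => i.val < r), t i)} =
      (Ideal.span {(MvPowerSeries.C (∏ i ∈ Finset.univ.filter (fun i : Fin (l + 2) => i.val < r), t i) : MvPowerSeries (Fin 2) A)}).map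
            (Ideal.Quotient.mk (Ideal.span {DeJong1996.nodeDeformationRelation A (∏ i ∈ Finset.univ.filter (fun i : Fin (l + 2) => i.val < s)
            , t i)})) := by
    rw [Ideal.map_span, Set.image_singleton]
    rfl
  rw [← hJ] at hB ⊢
  rw [hbd]
  -- the chart through `y`, the local ring `L/(f)` and the stalk ideals
  obtain ⟨j, g, hjg, 𝔔, h𝔔max, h𝔔, hall⟩ := modelChartsOverCentre_model_stalk (![MvPowerSeries.X 0, MvPowerSeries.X 1, MvPowerSeries.C (t a₀)
        , MvPowerSeries.C (t b₀)] : Fin 4 → MvPowerSeries (Fin 2) A) (fun k => MvPowerSeries.C ((fun k => t (σ k)) k))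
    hzP hdP 𝔓 h𝔓 hc (MvPowerSeries.C (∏ k ∈ (Finset.univ.filter (fun k : Fin l => (σ k).val < s)), (fun k => t (σ k)) k))
          (DeJong1996.nodeDeformationRelation A (∏ i ∈ Finset.univ.filter (fun i : Fin (l + 2) => i.val < s), t i)) hF ρ₁ hB yB hyc hy
  -- the chart package
  obtain ⟨f, hO, hfF, hG, hpack⟩ := modelChartsOverCentre_package (t a₀) (t b₀) (fun k => t (σ k)) (Finset.univ.filter (fun k : Fin l =>
        (σ k).val < s)) (Finset.univ.filter (fun k : Fin l => (σ k).val < r)) hST hzA hdA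
    (∏ i ∈ Finset.univ.filter (fun i : Fin (l + 2) => i.val < s), t i) (∏ i ∈ Finset.univ.filter (fun i : Fin (l + 2) => i.val < r)
          , t i) hh hbT 𝔓 h𝔓 j g hjg 𝔔 h𝔔 (fun f hf => (hall f hf).1) (Localization.AtPrime 𝔔)
  obtain ⟨Θ, hdict⟩ := (hall f hfF).2 (Localization.AtPrime 𝔔)
  -- the dictionary for the centre and the boundary
  have hgP : g ∈ 𝔓 := hjg ▸ hc j
  have hcentre := hdict 𝔓
  rw [RingEquiv.toRingHom_eq_coe,
    modelChartsOverCentre_map_comp_centre 𝔓 g (map_blowupAlgebra_eq_span hgP)] at hcentre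
  have hbdry := hdict (Ideal.span {(MvPowerSeries.C (∏ i ∈ Finset.univ.filter (fun i : Fin (l + 2) => i.val < r), t i) : MvPowerSeries (Fin 2) A)})
  rw [RingEquiv.toRingHom_eq_coe] at hbdry
  conv at hbdry => rhs; rw [modelChartsOverCentre_map_span_singleton]
  exact modelChartsOverCentre_transport Θ hcentre hbdry hG hpack

end Summit.ResolutionOfSingularities.ResolutionOfSingularities.Theorems

end
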